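import Mathlib.FieldTheory.IntermediateField.Adjoin.Basic
import Mathlib.RingTheory.AlgebraicIndependent.TranscendenceBasis
import Mathlib.LinearAlgebra.Basis.VectorSpace
import Mathlib.LinearAlgebra.FiniteDimensional.Lemmas
import Mathlib.Analysis.Complex.Exponential
import Literature.NumberTheory.Transcendental.SchanuelEclEmpty
import Literature.NumberTheory.Transcendental.KirbyRelativeSchanuel
import Literature.NumberTheory.Transcendental.KirbyWeakSchanuel
import Literature.NumberTheory.Transcendental.EclPregeometry
import HarnessLib

/-!
# Kirby's reduction of Schanuel's conjecture to `ecl(∅)` — proofs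

Sibling proof file of `SchanuelEclEmpty.lean` (named fact
`Literature.NumberTheory.Transcendental.schanuelConjecture_iff_ecl_empty`, [cite: Kirby2010, Prop. 7.2 and §1]).

J. Kirby, *Exponential algebraicity in exponential fields*, Bull. Lond. Math. Soc. 42 (2010)
879–890 (arXiv:0810.4285) proves (p. 11):

> **Proposition 7.2.** In any partial E-field `F`, if `ā` is an essential counterexample to the
> Schanuel property then `ā` is contained in `ecl^F(∅)`.
>
> *Proof.* Let `ā` be a tuple from `F`, write `⟨ā⟩_ℚ` for its `ℚ`-linear span, let
> `B = ⟨ā⟩_ℚ ∩ ecl^F(∅)`, and suppose that `ā ⊄ ecl^F(∅)`, so `⟨ā⟩_ℚ ≠ B`. Then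
> `td(ā, exp(ā)/B, exp(B)) ≥ td(ā, exp(ā)/ecl^F(∅))` and `ldim_ℚ(ā/B) = ldim_ℚ(ā/ecl^F(∅))`. So
> `δ(ā/B) ≥ δ(ā/ecl^F(∅)) ≥ dim^F(ā) ≥ 1` and thus `δ(B) = δ(ā) − δ(ā/B) < δ(ā)`, hence `ā` is
> not an essential counterexample.

together with (§1, p. 2) "every counterexample contains an essential counterexample in its
`ℚ`-linear span". The inputs are Theorem 1.2 (the weak Schanuel property
`δ(x̄/C) ≥ dim(x̄/C) ≥ 0` over `ecl`-closed `C`, from Ax 1971 Thm. 3) and Lemma 3.3 (`ecl` is a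
closure operator whose closed sets are E-subfields).

This file PROVES the architecture of that argument, i.e. the implication

  `Kirby2010_weakSchanuel ℂ ∧ Kirby2010_ecl_idem ℂ ∧ Kirby2010_ecl_isExpSubfield ℂ`
  `⟹ schanuelConjecture_iff_ecl_empty`

(`schanuelConjecture_iff_ecl_empty_of_Kirby2010`), through the intermediate fact
`kirby_relative_schanuel_complex` (= `Periods.kirby_weakSchanuel_ecl_empty`, Thm. 1.2 at
`F = ℂ_exp`, `C = ecl ∅`): `schanuelConjecture_iff_ecl_empty_of_kirby`. What remains unproved in
the tree are exactly Kirby's three printed results as named facts (`EclPregeometry.lean`):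
Thm. 1.2 (a theory: Ax's theorem via exponential derivations) and two items of Lemma 3.3
("a straightforward exercise" on Khovanskii systems).

## The proved reduction (direct form of Kirby's argument)

Let `E = ecl ∅ ⊆ ℂ` (an exp-closed subfield, hence a `ℚ`-subspace) and let `x̄ ∈ ℂⁿ` be
`ℚ`-linearly independent, `V = ⟨x̄⟩_ℚ`, `W = V ∩ E`, `U` a complement of `W` in `V`
(`k = dim W`, `m = dim U`, `k + m = n`). Pick bases `ȳ` of `W` and `z̄` of `U`; after clearing
denominators (`exists_nsmul_mem_span_int`) all `yᵢ, zⱼ` lie in the `ℤ`-span of `x̄`, so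
`ℚ(ȳ, z̄, e^{ȳ}, e^{z̄}) ⊆ ℚ(x̄, e^{x̄})` (`mem_adjoin_of_mem_span_int`) and `trdeg` is monotone.
Now `z̄` is `ℚ`-independent modulo `E` (`U ∩ E = 0`), so Thm. 1.2 gives
`m ≤ trdeg_{ℚ(E)} ℚ(E)(z̄, e^{z̄}) ≤ trdeg_{ℚ(ȳ,e^{ȳ})} ℚ(ȳ, e^{ȳ})(z̄, e^{z̄})` (base change
along `ℚ(ȳ, e^{ȳ}) ⊆ ℚ(E)`, `trdeg_adjoin_le_of_le`, using `exp E ⊆ E`), the hypothesis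
(Schanuel on `E`) gives `k ≤ trdeg_ℚ ℚ(ȳ, e^{ȳ})`, and the tower law adds them up
(`add_le_trdeg_adjoin_union`).

## Contents

* `AlgebraicIndependent.of_intermediateField_le`, `isAlgebraic_adjoin_over_algebraAdjoin`,
  `trdeg_adjoin_le_of_le` (base change lowers `trdeg` of a generated extension),
  `add_le_trdeg_adjoin_union` (tower), `exists_nsmul_mem_span_int`, `mem_adjoin_of_mem_span_int`
  — general lemmas [folklore].
* `schanuelConjecture_iff_ecl_empty_of_kirby`, `kirby_relative_schanuel_complex_of_weakSchanuel`,
  `kirby_weakSchanuel_ecl_empty_iff`, `schanuelConjecture_iff_ecl_empty_of_Kirby2010`.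

## References

* J. Kirby, *Exponential algebraicity in exponential fields*, Bull. Lond. Math. Soc. 42 (2010),
  879–890, doi:10.1112/blms/bdq044, arXiv:0810.4285: Thm. 1.2 (p. 1), §1 (p. 2, essential
  counterexamples), Lemma 3.3 (p. 4), Prop. 7.2 (p. 11).
* J. Ax, *On Schanuel's conjectures*, Ann. of Math. 93 (1971), 252–268, Thm. 3.
-/

noncomputable section

open IntermediateField

namespace Literature.NumberTheory.Transcendental

/-! ### Base change for transcendence degrees of generated extensions -/

/-- Algebraic independence over an intermediate field descends to a smaller intermediate field.
[folklore] -/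
theorem AlgebraicIndependent.of_intermediateField_le {K E : Type*} [Field K] [Field E]
    [Algebra K E] {F₁ F₂ : IntermediateField K E} (h : F₁ ≤ F₂) {ι : Type*} {v : ι → E}
    (hv : AlgebraicIndependent F₂ v) : AlgebraicIndependent F₁ v := by
  letI : Algebra F₁ F₂ := (IntermediateField.inclusion h).toRingHom.toAlgebra
  haveI : IsScalarTower F₁ F₂ E := IsScalarTower.of_algebraMap_eq (fun _ => rfl)
  exact hv.restrictScalars (IntermediateField.inclusion h).injective

/-- The intermediate field `F(S)` is algebraic over the `F`-subalgebra generated by (the preimage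
of) `S` inside it (it is its fraction field). [folklore] -/
theorem isAlgebraic_adjoin_over_algebraAdjoin {F E : Type*} [Field F] [Field E] [Algebra F E]
    (S : Set E) :
    Algebra.IsAlgebraic
      (Algebra.adjoin F (((↑) : adjoin F S → E) ⁻¹' S)) (adjoin F S) := by
  set A := adjoin F S
  set s : Set A := ((↑) : A → E) ⁻¹' S
  have hmap : (Algebra.adjoin F s).map A.val = Algebra.adjoin F S := by
    rw [AlgHom.map_adjoin]
    congr 1
    refine Set.image_preimage_eq_of_subset ?_
    intro x hx
    exact ⟨⟨x, subset_adjoin F S hx⟩, rfl⟩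
  refine ⟨fun a => ?_⟩
  obtain ⟨r, hr, q, hq, hrq⟩ := (mem_adjoin_iff_div (F := F) (S := S)).mp a.2
  rw [← hmap] at hr hq
  obtain ⟨r', hr', rfl⟩ := hr
  obtain ⟨q', hq', rfl⟩ := hq
  by_cases hq0 : q' = 0
  · have : a = 0 := by
      apply Subtype.ext
      rw [hrq, hq0]; simp
    rw [this]; exact isAlgebraic_zero
  · -- `a * q' = r'`, so `a` is a root of `q' X - r'`.
    have hq0' : (q' : E) ≠ 0 := fun h0 => hq0 (Subtype.ext h0)
    have haq : a * q' = r' := by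
      apply Subtype.ext
      show (a : E) * (q' : E) = (r' : E)
      rw [show (a : E) = (r' : E) / (q' : E) from hrq]
      exact div_mul_cancel₀ _ hq0'
    set q'' : Algebra.adjoin F s := ⟨q', hq'⟩
    set r'' : Algebra.adjoin F s := ⟨r', hr'⟩
    refine ⟨Polynomial.C q'' * Polynomial.X - Polynomial.C r'', ?_, ?_⟩
    · intro h0
      have := congrArg (fun p => Polynomial.coeff p 1) h0
      simp only [Polynomial.coeff_sub, Polynomial.coeff_C_mul, Polynomial.coeff_X_one, mul_one,
        Polynomial.coeff_C, if_neg (one_ne_zero), sub_zero, Polynomial.coeff_zero] at this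
      exact hq0 (congrArg Subtype.val this)
    · simp only [map_sub, map_mul, Polynomial.aeval_C, Polynomial.aeval_X]
      rw [sub_eq_zero]
      change (algebraMap (Algebra.adjoin F s) A q'') * a = algebraMap _ A r''
      rw [mul_comm]
      exact haq

/-- Base change can only lower the transcendence degree of a generated extension: for
intermediate fields `F₁ ≤ F₂` of `E/K` and `S ⊆ E`, `trdeg_{F₂} F₂(S) ≤ trdeg_{F₁} F₁(S)`
(a transcendence basis of `F₂(S)/F₂` inside `S` stays algebraically independent over `F₁`).
[folklore] -/
theorem trdeg_adjoin_le_of_le {K E : Type*} [Field K] [Field E] [Algebra K E]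
    {F₁ F₂ : IntermediateField K E} (h : F₁ ≤ F₂) (S : Set E) :
    Algebra.trdeg F₂ (adjoin F₂ S) ≤ Algebra.trdeg F₁ (adjoin F₁ S) := by
  haveI := isAlgebraic_adjoin_over_algebraAdjoin (F := F₂) S
  obtain ⟨t, hts, ht⟩ := exists_isTranscendenceBasis_subset (R := F₂) (A := adjoin F₂ S)
    (((↑) : adjoin F₂ S → E) ⁻¹' S)
  rw [← ht.cardinalMk_eq_trdeg]
  -- the same elements, viewed in `F₁(S)`
  let f : t → adjoin F₁ S := fun i => ⟨(i.1 : E), subset_adjoin F₁ S (hts i.2)⟩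
  have hf : AlgebraicIndependent F₁ f := by
    refine AlgebraicIndependent.of_comp (adjoin F₁ S).val ?_
    have h2 : AlgebraicIndependent F₂ (fun i : t => ((i : adjoin F₂ S) : E)) :=
      ht.1.map' (f := (adjoin F₂ S).val) (by
        intro a b hab; exact Subtype.ext hab)
    exact AlgebraicIndependent.of_intermediateField_le h h2
  exact hf.cardinalMk_le_trdeg


/-! ### Towers -/

/-- `trdeg` is additive along `K ⊆ K(S) ⊆ K(S)(T) = K(S ∪ T)` (`trdeg_add_eq`,
`adjoin_adjoin_left`): lower bounds add up. [folklore] -/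
theorem add_le_trdeg_adjoin_union {K E : Type*} [Field K] [Field E] [Algebra K E]
    (S T : Set E) {a b : Cardinal}
    (ha : a ≤ Algebra.trdeg K (adjoin K S))
    (hb : b ≤ Algebra.trdeg (adjoin K S) (adjoin (adjoin K S) T)) :
    a + b ≤ Algebra.trdeg K (adjoin K (S ∪ T)) := by
  have htower := trdeg_add_eq K (adjoin K S) (A := adjoin (adjoin K S) T)
  have heq : Algebra.trdeg K (adjoin (adjoin K S) T) = Algebra.trdeg K (adjoin K (S ∪ T)) := by
    rw [← (equivOfEq (adjoin_adjoin_left K S T)).trdeg_eq]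
    rfl
  calc a + b ≤ Algebra.trdeg K (adjoin K S) + Algebra.trdeg (adjoin K S) (adjoin (adjoin K S) T) :=
        add_le_add ha hb
    _ = Algebra.trdeg K (adjoin K (S ∪ T)) := by rw [htower, heq]

/-! ### Clearing denominators -/

/-- An element of the `ℚ`-span of a family has a positive integer multiple in its `ℤ`-span
(clearing denominators). [folklore] -/
theorem exists_nsmul_mem_span_int {ι M : Type*} [AddCommGroup M] [Module ℚ M] (v : ι → M)
    {a : M} (ha : a ∈ Submodule.span ℚ (Set.range v)) :
    ∃ N : ℕ, N ≠ 0 ∧ (N : ℚ) • a ∈ Submodule.span ℤ (Set.range v) := by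
  induction ha using Submodule.span_induction with
  | mem x hx => exact ⟨1, one_ne_zero, by simpa using Submodule.subset_span hx⟩
  | zero => exact ⟨1, one_ne_zero, by simp⟩
  | add x y _ _ hx hy =>
    obtain ⟨N₁, hN₁, h₁⟩ := hx
    obtain ⟨N₂, hN₂, h₂⟩ := hy
    refine ⟨N₁ * N₂, mul_ne_zero hN₁ hN₂, ?_⟩
    rw [smul_add]
    refine Submodule.add_mem _ ?_ ?_
    · have : ((N₁ * N₂ : ℕ) : ℚ) • x = (N₂ : ℤ) • ((N₁ : ℚ) • x) := by
        rw [← Int.cast_smul_eq_zsmul ℚ, smul_smul]; push_cast; ring_nf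
      rw [this]; exact Submodule.smul_mem _ _ h₁
    · have : ((N₁ * N₂ : ℕ) : ℚ) • y = (N₁ : ℤ) • ((N₂ : ℚ) • y) := by
        rw [← Int.cast_smul_eq_zsmul ℚ, smul_smul]; push_cast; ring_nf
      rw [this]; exact Submodule.smul_mem _ _ h₂
  | smul q x _ hx =>
    obtain ⟨N, hN, h⟩ := hx
    refine ⟨q.den * N, mul_ne_zero q.den_nz hN, ?_⟩
    have : ((q.den * N : ℕ) : ℚ) • q • x = q.num • ((N : ℚ) • x) := by
      rw [← Int.cast_smul_eq_zsmul ℚ, smul_smul, smul_smul]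
      congr 1
      push_cast
      rw [mul_right_comm, Rat.den_mul_eq_num]
    rw [this]; exact Submodule.smul_mem _ _ h

/-- The `ℤ`-span of `x₁, …, xₙ` lies in `ℚ(x̄, e^{x̄})`, and so does its image under `exp`
(`e^{Σ mᵢ xᵢ} = Π (e^{xᵢ})^{mᵢ}`). [folklore] -/
theorem mem_adjoin_of_mem_span_int {ι : Type*} (x : ι → ℂ) {a : ℂ}
    (ha : a ∈ Submodule.span ℤ (Set.range x)) :
    a ∈ adjoin ℚ (Set.range x ∪ Set.range (Complex.exp ∘ x)) ∧
      Complex.exp a ∈ adjoin ℚ (Set.range x ∪ Set.range (Complex.exp ∘ x)) := by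
  set Kx := adjoin ℚ (Set.range x ∪ Set.range (Complex.exp ∘ x))
  induction ha using Submodule.span_induction with
  | mem b hb =>
    obtain ⟨i, rfl⟩ := hb
    exact ⟨subset_adjoin ℚ _ (Or.inl ⟨i, rfl⟩), subset_adjoin ℚ _ (Or.inr ⟨i, rfl⟩)⟩
  | zero => exact ⟨zero_mem Kx, by rw [Complex.exp_zero]; exact one_mem Kx⟩
  | add b c _ _ hb hc =>
    exact ⟨add_mem hb.1 hc.1, by rw [Complex.exp_add]; exact mul_mem hb.2 hc.2⟩
  | smul m b _ hb =>
    refine ⟨zsmul_mem hb.1 m, ?_⟩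
    rw [zsmul_eq_mul, Complex.exp_int_mul]
    exact zpow_mem hb.2 m

end Literature.NumberTheory.Transcendental

/-! ### The reduction -/

namespace Literature.NumberTheory.Transcendental

open Submodule in
/-- **Kirby's reduction** (Kirby 2010, Prop. 7.2 with §1, p. 2 and p. 11): the relative Schanuel
theorem over `ecl ∅` (`kirby_relative_schanuel_complex`, Thm. 1.2 at `F = ℂ_exp`, `C = ecl ∅`)
and the fact that `ecl ∅` is an exp-closed subfield (`Kirby2010_ecl_isExpSubfield ℂ`,
Lemma 3.3) imply that Schanuel's conjecture (`SchanuelProperty ℂ`) is equivalent to its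
restriction to `ℚ`-linearly independent tuples from `ecl ∅`. The forward implication is trivial;
the converse is the argument displayed in the module docstring. [cite: Kirby2010, Prop. 7.2] -/
theorem schanuelConjecture_iff_ecl_empty_of_kirby
    (hrel : Literature.NumberTheory.Transcendental.kirby_relative_schanuel_complex) (hE : Literature.NumberTheory.Transcendental.Kirby2010_ecl_isExpSubfield ℂ) :
    schanuelConjecture_iff_ecl_empty := by
  refine ⟨fun h n x _ hx => h n x hx, fun H => ?_⟩
  intro n x hx
  obtain ⟨⟨SE, hSE⟩, hexp⟩ := hE ∅
  -- `E = ecl ∅` as a `ℚ`-subspace of `ℂ`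
  let Eq : Submodule ℚ ℂ :=
    { carrier := ecl (∅ : Set ℂ)
      add_mem' := fun {a b} ha hb => by
        rw [← hSE] at ha hb ⊢; exact SE.add_mem ha hb
      zero_mem' := by rw [← hSE]; exact SE.zero_mem
      smul_mem' := fun q {a} ha => by
        rw [← hSE] at ha ⊢
        rw [Rat.smul_def]
        exact SE.mul_mem (SubfieldClass.ratCast_mem SE q) ha }
  have hEq : (Eq : Set ℂ) = ecl (∅ : Set ℂ) := rfl
  have hspanE : span ℚ (ecl (∅ : Set ℂ)) = Eq := by rw [← hEq, span_eq]
  -- the `ℚ`-span `V` of `x̄`, `W = V ∩ E` and a complement `U` of `W` in `V`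
  set V : Submodule ℚ ℂ := span ℚ (Set.range x) with hV
  haveI : FiniteDimensional ℚ V := FiniteDimensional.span_of_finite ℚ (Set.finite_range x)
  set W : Submodule ℚ ℂ := V ⊓ Eq with hW
  obtain ⟨U', hU'⟩ := W.exists_isCompl
  set U : Submodule ℚ ℂ := V ⊓ U' with hU
  haveI : FiniteDimensional ℚ W := Submodule.finiteDimensional_of_le inf_le_left
  haveI : FiniteDimensional ℚ U := Submodule.finiteDimensional_of_le inf_le_left
  have hWU_sup : W ⊔ U = V := by
    rw [hU, inf_comm, ← sup_inf_assoc_of_le U' (inf_le_left : W ≤ V), hU'.sup_eq_top, top_inf_eq]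
  have hWU_disj : Disjoint W U := hU'.disjoint.mono_right inf_le_right
  have hUE_disj : Disjoint U Eq := by
    rw [disjoint_def]
    intro a haU haE
    exact (disjoint_def.mp hWU_disj) a ⟨inf_le_left (b := U') haU, haE⟩ haU
  -- dimensions
  set k := Module.finrank ℚ W
  set m := Module.finrank ℚ U
  have hn : k + m = n := by
    have h1 := Submodule.finrank_sup_add_finrank_inf_eq W U
    rw [hWU_disj.eq_bot, finrank_bot, add_zero, hWU_sup] at h1
    rw [← h1, hV, finrank_span_eq_card hx, Fintype.card_fin]
  -- bases
  let bW := Module.finBasis ℚ W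
  let bU := Module.finBasis ℚ U
  let y : Fin k → ℂ := fun i => (bW i : ℂ)
  let z : Fin m → ℂ := fun j => (bU j : ℂ)
  have hy_mem : ∀ i, y i ∈ ecl (∅ : Set ℂ) := fun i => ((bW i).2 : (bW i : ℂ) ∈ V ⊓ Eq).2
  have hy_V : ∀ i, y i ∈ V := fun i => ((bW i).2 : (bW i : ℂ) ∈ V ⊓ Eq).1
  have hz_U : ∀ j, z j ∈ U := fun j => (bU j).2
  have hz_V : ∀ j, z j ∈ V := fun j => inf_le_left (b := U') (hz_U j)
  have hy_li : LinearIndependent ℚ y := bW.linearIndependent.map' W.subtype W.ker_subtype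
  have hz_li : LinearIndependent ℚ z := bU.linearIndependent.map' U.subtype U.ker_subtype
  -- clearing denominators
  choose Ny hNy hNy_mem using fun i => Literature.NumberTheory.Transcendental.exists_nsmul_mem_span_int x (hy_V i)
  choose Nz hNz hNz_mem using fun j => Literature.NumberTheory.Transcendental.exists_nsmul_mem_span_int x (hz_V j)
  let cy : Fin k → ℚˣ := fun i => Units.mk0 (Ny i : ℚ) (Nat.cast_ne_zero.mpr (hNy i))
  let cz : Fin m → ℚˣ := fun j => Units.mk0 (Nz j : ℚ) (Nat.cast_ne_zero.mpr (hNz j))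
  let y' : Fin k → ℂ := fun i => (Ny i : ℚ) • y i
  let z' : Fin m → ℂ := fun j => (Nz j : ℚ) • z j
  have hy'_eq : cy • y = y' := by
    funext i; simp only [Pi.smul_apply', cy, y', Units.smul_def, Units.val_mk0]
  have hz'_eq : cz • z = z' := by
    funext j; simp only [Pi.smul_apply', cz, z', Units.smul_def, Units.val_mk0]
  have hy'_li : LinearIndependent ℚ y' := hy'_eq ▸ hy_li.units_smul cy
  have hz'_li : LinearIndependent ℚ z' := hz'_eq ▸ hz_li.units_smul cz
  have hy'_mem : ∀ i, y' i ∈ ecl (∅ : Set ℂ) := fun i => Eq.smul_mem _ (hy_mem i)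
  have hz'_U : ∀ j, z' j ∈ U := fun j => U.smul_mem _ (hz_U j)
  have hz'_modE : LinearIndependent ℚ ((span ℚ (ecl (∅ : Set ℂ))).mkQ ∘ z') := by
    refine hz'_li.map ?_
    rw [ker_mkQ, hspanE]
    exact hUE_disj.mono_left (span_le.mpr (Set.range_subset_iff.mpr hz'_U))
  -- the field-theoretic estimate
  set Sy := Set.range y' ∪ Set.range (Complex.exp ∘ y') with hSy
  set Sz := Set.range z' ∪ Set.range (Complex.exp ∘ z') with hSz
  set Ky := adjoin ℚ Sy with hKy
  set L := adjoin ℚ (ecl (∅ : Set ℂ)) with hL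
  have hk : (k : Cardinal) ≤ Algebra.trdeg ℚ Ky := H k y' hy'_mem hy'_li
  have hm₀ : (m : Cardinal) ≤ Algebra.trdeg L (adjoin L Sz) := hrel m z' hz'_modE
  have hKyL : Ky ≤ L := by
    rw [hKy, adjoin_le_iff]
    rintro a (⟨i, rfl⟩ | ⟨i, rfl⟩)
    · exact subset_adjoin ℚ _ (hy'_mem i)
    · exact subset_adjoin ℚ _ (hexp _ (hy'_mem i))
  have hm : (m : Cardinal) ≤ Algebra.trdeg Ky (adjoin Ky Sz) :=
    hm₀.trans (Literature.NumberTheory.Transcendental.trdeg_adjoin_le_of_le hKyL Sz)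
  have hkm : (k : Cardinal) + m ≤ Algebra.trdeg ℚ (adjoin ℚ (Sy ∪ Sz)) :=
    Literature.NumberTheory.Transcendental.add_le_trdeg_adjoin_union Sy Sz hk hm
  -- comparison with `ℚ(x̄, e^{x̄})`
  set Kx := adjoin ℚ (Set.range x ∪ Set.range (Complex.exp ∘ x)) with hKx
  have hle : adjoin ℚ (Sy ∪ Sz) ≤ Kx := by
    rw [adjoin_le_iff]
    rintro a ((⟨i, rfl⟩ | ⟨i, rfl⟩) | (⟨j, rfl⟩ | ⟨j, rfl⟩))
    · exact (Literature.NumberTheory.Transcendental.mem_adjoin_of_mem_span_int x (hNy_mem i)).1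
    · exact (Literature.NumberTheory.Transcendental.mem_adjoin_of_mem_span_int x (hNy_mem i)).2
    · exact (Literature.NumberTheory.Transcendental.mem_adjoin_of_mem_span_int x (hNz_mem j)).1
    · exact (Literature.NumberTheory.Transcendental.mem_adjoin_of_mem_span_int x (hNz_mem j)).2
  have hfin : Algebra.trdeg ℚ (adjoin ℚ (Sy ∪ Sz)) ≤ Algebra.trdeg ℚ Kx :=
    trdeg_le_of_injective (inclusion hle) (inclusion_injective hle)
  calc (n : Cardinal) = (k : Cardinal) + m := by rw [← hn, Nat.cast_add]
    _ ≤ Algebra.trdeg ℚ (adjoin ℚ (Sy ∪ Sz)) := hkm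
    _ ≤ Algebra.trdeg ℚ Kx := hfin

/-- `Literature.NumberTheory.Transcendental.kirby_weakSchanuel_ecl_empty` (file `KirbyWeakSchanuel`) and
`Literature.NumberTheory.Transcendental.kirby_relative_schanuel_complex` (file `KirbyRelativeSchanuel`) are the same statement
(definitionally). [cite: Kirby2010, Thm. 1.2] -/
theorem kirby_weakSchanuel_ecl_empty_iff :
    kirby_weakSchanuel_ecl_empty ↔ Literature.NumberTheory.Transcendental.kirby_relative_schanuel_complex := Iff.rfl

open Submodule in
/-- Kirby's Thm. 1.2 in the general form `Kirby2010_weakSchanuel ℂ` (`ldim_ℚ(x̄/C) ≤ td(x̄, e^{x̄}/C)`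
for `ecl`-closed `C`), together with idempotence of `ecl` (Lemma 3.3, making `ecl ∅` `ecl`-closed),
gives the specialised fact `kirby_relative_schanuel_complex`. [cite: Kirby2010, Thm. 1.2] -/
theorem kirby_relative_schanuel_complex_of_weakSchanuel (h : Literature.NumberTheory.Transcendental.Kirby2010_weakSchanuel ℂ)
    (hidem : Literature.NumberTheory.Transcendental.Kirby2010_ecl_idem ℂ) : Literature.NumberTheory.Transcendental.kirby_relative_schanuel_complex := by
  intro n x hx
  have h1 := h.ecl_empty hidem x
  have h2 : Literature.NumberTheory.Transcendental.relLinDim (ecl (∅ : Set ℂ)) x = n := by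
    rw [Literature.NumberTheory.Transcendental.relLinDim, finrank_span_eq_card hx, Fintype.card_fin]
  rw [h2] at h1
  exact h1

/-- **The named fact from Kirby's three printed results.** `schanuelConjecture_iff_ecl_empty`
follows from Kirby 2010 Thm. 1.2 (`Kirby2010_weakSchanuel ℂ`) and Lemma 3.3
(`Kirby2010_ecl_idem ℂ`, `Kirby2010_ecl_isExpSubfield ℂ`). [cite: Kirby2010, Prop. 7.2] -/
theorem schanuelConjecture_iff_ecl_empty_of_Kirby2010 (h : Literature.NumberTheory.Transcendental.Kirby2010_weakSchanuel ℂ)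
    (hidem : Literature.NumberTheory.Transcendental.Kirby2010_ecl_idem ℂ) (hE : Literature.NumberTheory.Transcendental.Kirby2010_ecl_isExpSubfield ℂ) :
    schanuelConjecture_iff_ecl_empty :=
  schanuelConjecture_iff_ecl_empty_of_kirby (kirby_relative_schanuel_complex_of_weakSchanuel h hidem)
    hE

end Literature.NumberTheory.Transcendental

end
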